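import Mathlib
import Summits.ValiantsHypothesis.ValiantsHypothesis.Theses.ElementaryWordLength
import Literature.Computability.AlgebraicComplexity.ReadKDeterminantalRepresentationsProofs

/-!
# Line `SketchIdeator2` — skeleton for crux `UnboundedReads` (stmt-ValiantsHypothesis-6627)

Route `ElementaryWordLength`, crux decl
`Summit.ValiantsHypothesis.ValiantsHypothesis.Theses.ElementaryWordLength.UnboundedReads`
(`∀ k, ∃ n₀, ∀ n ≥ n₀, ∀ w, legal w → ∏ w = E₀₂(per_n) → ∃ x, k < #letters of w reading x`).

## The line (card `transversal-transcendence` of `SketchIdeator2.lean`, reshaped by the lead)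

Fix `k`.  Take a TRANSVERSAL block of CONSTANT size `b = 2(k+5)`: the diagonal positions
`ζ i = (i, i)`, `i < b` (distinct rows, distinct columns).  For a word `w` let `ℓ` be the number of its
letters reading a block variable; if every variable is read `≤ k` times then `ℓ ≤ k·b`.

1. `Stmt.stub_segments` (word side, the load-bearing stub): the block letters cut `w` into `ℓ+1`
   block-free segments.  For EVERY substitution `S` that keeps the block variables and sends every other
   variable to a constant, the substituted segments are constant `3×3` matrices, so the `(0,2)` entry of
   the substituted product is obtained from ONE polynomial `D` (depending on `w` only) in the block
   variables and `9(ℓ+1)` generic segment-entry parameters, by evaluating the parameters at a point of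
   `ℂ^(9(ℓ+1))`.
2. `Stmt.stub_universalCount` (per side, in-tree Hrubeš–Joglekar machinery): if `per_n` has such a generic
   form with parameter type `π` for a block of `b` well-placed positions and `n ≥ 2^(b+3) ≥ |V b|`, then
   `2^b ≤ |π|` — every family of `2^b` coefficients is realised by a substitution of constants outside the
   block (`exists_subst_perPoly_eq`), so the coefficient map `ℂ^π → ℂ^(2^b)` is onto
   (`eval_coeff_sumAlgEquiv`, `coeff_sum_C_mul_prod_ite_X`) and `card_le_card_of_surjective_eval` applies.
COMPOSITION `UnboundedReads_of : Stmt.stub_segments → Stmt.stub_universalCount → UnboundedReads`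
(kernel-checked, no sorry): `2^b ≤ 9(ℓ+1) ≤ 9(kb+1) < 2^b` for `b = 2(k+5)`, `n₀ = 2^(b+3)`.

## Shape (D-0027 §3.3)
* `Stmt.stub_…` — the two stub statements as precise `Prop`s (over Mathlib + Literature only, letters
  inlined exactly as in the route file, so the landed stubs need no new definition);
* `stub_…` — the same statements as sorried theorems (the REGISTERED stubs; `sorry` nowhere else);
* `UnboundedReads_of` — the composition, real proof; `UnboundedReads_proof := UnboundedReads_of stub_…`.

## Disproof used
None exists for this crux at registration time (no `Cruxes/UnboundedReads/Disproof.lean`, 2026-08-16).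
The line uses both crux hypotheses honestly: the product identity feeds `stub_segments`/`stub_universalCount`
(the `(0,2)` entry is `per_n`); legality `l.1 ≠ l.2.1` is NOT needed (the count works for arbitrary letters).
-/

namespace Summit.ValiantsHypothesis.ValiantsHypothesis.Cruxes.UnboundedReads.SketchIdeator2

open MvPolynomial

open Literature.Computability.AlgebraicComplexity (perPoly)

/-! ## Stub statements -/

/-- **Stub 1 (word side: generic segment form).**  For a word `w` over the variables `Fin n × Fin n`
and block positions `ζ : Fin b → Fin n × Fin n`, let `ℓ` be the number of letters of `w` reading a
block variable.  There is a polynomial `D` in the original variables and `(ℓ+1)·3·3` parameters such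
that for every substitution `S` fixing the block variables and constant elsewhere, the `(0,2)` entry of
the substituted word product is `D` with its parameters evaluated at some point of `ℂ^((ℓ+1)·9)`
(namely the entries of the `ℓ+1` substituted block-free segment products). -/
def Stmt.stub_segments : Prop :=
  ∀ (n b : ℕ) (ζ : Fin b → Fin n × Fin n) (w : List (Fin 3 × Fin 3 × ℂ × Option (Fin n × Fin n))),
    ∃ D : MvPolynomial ((Fin n × Fin n) ⊕
        (Fin ((w.filter (fun l => decide (∃ i, l.2.2.2 = some (ζ i)))).length + 1) × Fin 3 × Fin 3)) ℂ,
      ∀ S : Fin n × Fin n → MvPolynomial (Fin n × Fin n) ℂ,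
        (∀ i, S (ζ i) = MvPolynomial.X (ζ i)) →
        (∀ e, (∀ i, ζ i ≠ e) → ∃ a : ℂ, S e = MvPolynomial.C a) →
        ∃ x : Fin ((w.filter (fun l => decide (∃ i, l.2.2.2 = some (ζ i)))).length + 1) × Fin 3 × Fin 3 → ℂ,
          MvPolynomial.aeval (Sum.elim MvPolynomial.X (fun p => MvPolynomial.C (x p))) D =
            MvPolynomial.aeval S (((w.map (fun l => Matrix.transvection l.1 l.2.1
              (MvPolynomial.C l.2.2.1 * l.2.2.2.elim 1 MvPolynomial.X))).prod) 0 2)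

/-- **Stub 2 (per side: universality + parameter count).**  If `n ≥ 2^(b+3)`, `ζ : Fin b → Fin n × Fin n`
has distinct rows and distinct columns, and `per_n` has a generic form `D` over a finite parameter type
`π` (for every substitution fixing the block and constant elsewhere, the substituted permanent is a
parameter evaluation of `D`), then `2^b ≤ |π|`. -/
def Stmt.stub_universalCount : Prop :=
  ∀ (n b : ℕ) (ζ : Fin b → Fin n × Fin n), Function.Injective (fun i => (ζ i).1) →
    Function.Injective (fun i => (ζ i).2) → 2 ^ (b + 3) ≤ n →
    ∀ (π : Type) [Fintype π],
      (∃ D : MvPolynomial ((Fin n × Fin n) ⊕ π) ℂ,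
        ∀ S : Fin n × Fin n → MvPolynomial (Fin n × Fin n) ℂ,
          (∀ i, S (ζ i) = MvPolynomial.X (ζ i)) →
          (∀ e, (∀ i, ζ i ≠ e) → ∃ a : ℂ, S e = MvPolynomial.C a) →
          ∃ x : π → ℂ, MvPolynomial.aeval (Sum.elim MvPolynomial.X (fun p => MvPolynomial.C (x p))) D =
            MvPolynomial.aeval S (perPoly (Fin n) ℂ)) →
      2 ^ b ≤ Fintype.card π

/-! ## Registered stubs (sorried; `sorry` occurs nowhere else in this file) -/

/-- Registered stub `stub_segments` = `Stmt.stub_segments` spelled out. -/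
theorem stub_segments :
    ∀ (n b : ℕ) (ζ : Fin b → Fin n × Fin n) (w : List (Fin 3 × Fin 3 × ℂ × Option (Fin n × Fin n))),
    ∃ D : MvPolynomial ((Fin n × Fin n) ⊕
        (Fin ((w.filter (fun l => decide (∃ i, l.2.2.2 = some (ζ i)))).length + 1) × Fin 3 × Fin 3)) ℂ,
      ∀ S : Fin n × Fin n → MvPolynomial (Fin n × Fin n) ℂ,
        (∀ i, S (ζ i) = MvPolynomial.X (ζ i)) →
        (∀ e, (∀ i, ζ i ≠ e) → ∃ a : ℂ, S e = MvPolynomial.C a) →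
        ∃ x : Fin ((w.filter (fun l => decide (∃ i, l.2.2.2 = some (ζ i)))).length + 1) × Fin 3 × Fin 3 → ℂ,
          MvPolynomial.aeval (Sum.elim MvPolynomial.X (fun p => MvPolynomial.C (x p))) D =
            MvPolynomial.aeval S (((w.map (fun l => Matrix.transvection l.1 l.2.1
              (MvPolynomial.C l.2.2.1 * l.2.2.2.elim 1 MvPolynomial.X))).prod) 0 2) := by
  sorry

/-- Registered stub `stub_universalCount` = `Stmt.stub_universalCount` spelled out. -/
theorem stub_universalCount :
    ∀ (n b : ℕ) (ζ : Fin b → Fin n × Fin n), Function.Injective (fun i => (ζ i).1) →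
    Function.Injective (fun i => (ζ i).2) → 2 ^ (b + 3) ≤ n →
    ∀ (π : Type) [Fintype π],
      (∃ D : MvPolynomial ((Fin n × Fin n) ⊕ π) ℂ,
        ∀ S : Fin n × Fin n → MvPolynomial (Fin n × Fin n) ℂ,
          (∀ i, S (ζ i) = MvPolynomial.X (ζ i)) →
          (∀ e, (∀ i, ζ i ≠ e) → ∃ a : ℂ, S e = MvPolynomial.C a) →
          ∃ x : π → ℂ, MvPolynomial.aeval (Sum.elim MvPolynomial.X (fun p => MvPolynomial.C (x p))) D =
            MvPolynomial.aeval S (perPoly (Fin n) ℂ)) →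
      2 ^ b ≤ Fintype.card π := by
  sorry

/-! ## Proved tools of the line (sorry-free) -/

/-- Counting helper: if every element satisfying `P` satisfies some `Q i`, the `P`-filter is no
longer than the sum of the `Q i`-filters. (From `Sketch_ideator1.lean`, kernel-checked there.) -/
theorem filter_length_le_sum {α ι : Type} [Fintype ι] [DecidableEq ι] (w : List α) (P : α → Bool)
    (Q : ι → α → Bool) (hPQ : ∀ a, P a = true → ∃ i, Q i a = true) :
    (w.filter P).length ≤ ∑ i, (w.filter (Q i)).length := by
  induction w with
  | nil => simp
  | cons a w ih =>
    simp only [List.filter_cons]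
    have hmono : ∀ j, (w.filter (Q j)).length ≤
        (if Q j a = true then a :: w.filter (Q j) else w.filter (Q j)).length := fun j => by
      split <;> simp
    by_cases hP : P a = true
    · obtain ⟨i, hi⟩ := hPQ a hP
      have hi' : (w.filter (Q i)).length + 1 ≤
          (if Q i a = true then a :: w.filter (Q i) else w.filter (Q i)).length := by simp [hi]
      rw [if_pos hP, List.length_cons]
      calc (w.filter P).length + 1 ≤ (∑ j, (w.filter (Q j)).length) + 1 := by omega
        _ = (∑ j ∈ Finset.univ.erase i, (w.filter (Q j)).length) + ((w.filter (Q i)).length + 1) := by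
            rw [← Finset.sum_erase_add _ _ (Finset.mem_univ i)]; ring
        _ ≤ (∑ j ∈ Finset.univ.erase i,
              (if Q j a = true then a :: w.filter (Q j) else w.filter (Q j)).length) +
            (if Q i a = true then a :: w.filter (Q i) else w.filter (Q i)).length :=
            add_le_add (Finset.sum_le_sum fun j _ => hmono j) hi'
        _ = ∑ j, (if Q j a = true then a :: w.filter (Q j) else w.filter (Q j)).length := by
            rw [← Finset.sum_erase_add _ _ (Finset.mem_univ i)]
    · rw [if_neg hP]
      exact le_trans ih (Finset.sum_le_sum fun j _ => hmono j)

/-- The arithmetic of the composition: `9 (k b + 1) < 2 ^ b` for `b = 2 (k + 5)`. -/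
theorem nine_mul_lt_two_pow (k : ℕ) : 9 * (k * (2 * (k + 5)) + 1) < 2 ^ (2 * (k + 5)) := by
  have h1 : k + 5 < 2 ^ (k + 5) := Nat.lt_two_pow_self
  have h2 : 2 ^ (2 * (k + 5)) = 2 ^ (k + 5) * 2 ^ (k + 5) := by rw [two_mul, pow_add]
  have h3 : 32 * (k + 1) ≤ 2 ^ (k + 5) := by
    have : k + 1 ≤ 2 ^ k := Nat.lt_two_pow_self
    calc 32 * (k + 1) ≤ 32 * 2 ^ k := by omega
      _ = 2 ^ (k + 5) := by rw [pow_add]; norm_num; ring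
  rw [h2]
  calc 9 * (k * (2 * (k + 5)) + 1) < 32 * (k + 1) * (32 * (k + 1)) := by nlinarith
    _ ≤ 2 ^ (k + 5) * 2 ^ (k + 5) := Nat.mul_le_mul h3 h3

/-! ## Composition -/

/-- **Composition.** The two stubs give the crux: with `b = 2(k+5)` and `n ≥ 2^(b+3)`, a legal word
for `E₀₂(per_n)` all of whose variables are read `≤ k` times has `ℓ ≤ k b` block letters, so
`2^b ≤ 9(ℓ+1) ≤ 9(kb+1) < 2^b`. -/
theorem UnboundedReads_of : Stmt.stub_segments → Stmt.stub_universalCount →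
    Summit.ValiantsHypothesis.ValiantsHypothesis.Theses.ElementaryWordLength.UnboundedReads := by
  intro hseg hcount k
  refine ⟨2 ^ (2 * (k + 5) + 3), fun n hn w _hw hprod => ?_⟩
  by_contra hcon
  push Not at hcon
  -- the block
  have hbn : 2 * (k + 5) ≤ n :=
    le_trans (Nat.lt_two_pow_self).le (le_trans (Nat.pow_le_pow_right two_pos (by omega)) hn)
  set ζ : Fin (2 * (k + 5)) → Fin n × Fin n := fun i => (Fin.castLE hbn i, Fin.castLE hbn i) with hζ
  have hr : Function.Injective (fun i => (ζ i).1) := fun i j h => Fin.castLE_injective hbn h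
  have hc : Function.Injective (fun i => (ζ i).2) := fun i j h => Fin.castLE_injective hbn h
  -- the (0,2) entry of the word product is `per_n`
  have hper : ((w.map (fun l => Matrix.transvection l.1 l.2.1
      (MvPolynomial.C l.2.2.1 * l.2.2.2.elim 1 MvPolynomial.X))).prod) 0 2 = perPoly (Fin n) ℂ := by
    rw [hprod]
    simp [Matrix.transvection]
  -- stub 1: the generic segment form of the word; stub 2: the count
  obtain ⟨D, hD⟩ := hseg n (2 * (k + 5)) ζ w
  have h2b := hcount n (2 * (k + 5)) ζ hr hc hn _ ⟨D, by rw [← hper]; exact hD⟩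
  simp only [Fintype.card_prod, Fintype.card_fin] at h2b
  -- `ℓ ≤ b k` by the read bound
  have hℓ : (w.filter (fun l => decide (∃ i, l.2.2.2 = some (ζ i)))).length ≤ 2 * (k + 5) * k := by
    calc (w.filter (fun l => decide (∃ i, l.2.2.2 = some (ζ i)))).length
        ≤ ∑ i : Fin (2 * (k + 5)), (w.filter (fun l => decide (l.2.2.2 = some (ζ i)))).length :=
          filter_length_le_sum w _ (fun i l => decide (l.2.2.2 = some (ζ i))) (by
            intro a ha
            simpa using ha)
      _ ≤ ∑ _i : Fin (2 * (k + 5)), k := Finset.sum_le_sum fun i _ => hcon (ζ i)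
      _ = 2 * (k + 5) * k := by simp
  have := nine_mul_lt_two_pow k
  have h4 : ((w.filter (fun l => decide (∃ i, l.2.2.2 = some (ζ i)))).length + 1) * 3 * 3 ≤
      9 * (k * (2 * (k + 5)) + 1) := by nlinarith
  omega

/-- The crux from the registered stubs (compiler check that the two copies of each statement agree). -/
theorem UnboundedReads_proof :
    Summit.ValiantsHypothesis.ValiantsHypothesis.Theses.ElementaryWordLength.UnboundedReads :=
  UnboundedReads_of stub_segments stub_universalCount

end Summit.ValiantsHypothesis.ValiantsHypothesis.Cruxes.UnboundedReads.SketchIdeator2
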